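import Summits.QuantumAdvantage.QuantumAdvantage.Theorems.CubicForrelationNearExactIsExactTwelvePartnerR4Blocks
import Summits.QuantumAdvantage.QuantumAdvantage.Theorems.CubicForrelationNearExactIsExactTwelvePartnerLeaves

/-!
# Crux `CubicForrelation.NearExactIsExact` (stmt-QuantumAdvantage-14043) — n = 12, E1280-even, R4 leaf "descendant 0, w = 3" ASSEMBLED
  (E1280-HANDPROOFS.md §2.4): normal-form frame data + pairing partner ⇒ contradiction, for `rank Ξ = 4` and `rank Ξ = 6`

Certificate seat `b2b-cforr-cert` (gen 39).  HONEST FRAMING: kernel-checked (standard axioms) end-to-end versions of the last R4 leaf in the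
coefficient-tensor language: the slices of `d` in the normal form `y∧ω + v₀∧(Ξ + Σ_t v_t∧y_t)` (…TwelvePartnerR4Blocks hypotheses), `Ξ` in
symplectic normal form up to its radical (`rank 4`: columns `4,5,6` vanish and the `4×4` block is injective; `rank 6`: column `6` vanishes and
the `6×6` block is injective — this is how the frame delivers `rad Ξ`), and the partner equations ⇒ `False`, via `tpc4_Z`, `tpc4_scalars`
and `tpl_R4_Z_rank4_core` / `tpl_R4_Z_rank6_core`.  Replaces fam_RZ (30 × 2²¹, kit j226244) and g36's DZ6 SAT leaves.  NOT summit progress.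
-/

set_option linter.dupNamespace false -- D-0017: single-problem summit ⇒ `QuantumAdvantage.QuantumAdvantage` by design

namespace Summit.QuantumAdvantage.QuantumAdvantage.Theorems.CubicForrelation.NearExactIsExact

open Finset Matrix

section R4ZLeaf

variable (c d : Fin (5 + 7) → Fin (5 + 7) → Fin (5 + 7) → ZMod 2)
  (hcs : ∀ p j k, c p k j = c p j k) (hcc : ∀ p j k, c j p k = c p j k) (hcd : ∀ p j, c p j j = 0)
  (hpair : ∀ p φ, (∑ j, ∑ k, (if j < k then c p j k * d φ j k else 0)) = if p = φ then 1 else 0)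
  (Ξ : Fin 7 → Fin 7 → ZMod 2) (hΞs : ∀ j k, Ξ k j = Ξ j k) (Y : Fin 3 → Fin 7 → ZMod 2)
  (hdy_κκ : ∀ a b : Fin 5, d (Fin.castAdd 7 0) (Fin.castAdd 7 a) (Fin.castAdd 7 b) =
    (if (a = 1 ∧ b = 2) ∨ (a = 2 ∧ b = 1) then 1 else 0) + (if (a = 3 ∧ b = 4) ∨ (a = 4 ∧ b = 3) then 1 else 0))
  (hdy_κσ : ∀ (a : Fin 5) (s : Fin 7), d (Fin.castAdd 7 0) (Fin.castAdd 7 a) (Fin.natAdd 5 s) = 0)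
  (hdy_σσ : ∀ s u : Fin 7, d (Fin.castAdd 7 0) (Fin.natAdd 5 s) (Fin.natAdd 5 u) = 0)
  (hdv0_κκ : ∀ a b : Fin 5, d (Fin.castAdd 7 1) (Fin.castAdd 7 a) (Fin.castAdd 7 b) = if (a = 0 ∧ b = 2) ∨ (a = 2 ∧ b = 0) then 1 else 0)
  (hdv0_κσ : ∀ (a : Fin 5) (s : Fin 7), d (Fin.castAdd 7 1) (Fin.castAdd 7 a) (Fin.natAdd 5 s) =
    ∑ t : Fin 3, (if a = Fin.natAdd 2 t then Y t s else 0))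
  (hdv0_σσ : ∀ s u : Fin 7, d (Fin.castAdd 7 1) (Fin.natAdd 5 s) (Fin.natAdd 5 u) = Ξ s u)
  (hdv_κκ : ∀ (t : Fin 3) (a b : Fin 5), d (Fin.castAdd 7 (Fin.natAdd 2 t)) (Fin.castAdd 7 a) (Fin.castAdd 7 b) =
    if (a = 0 ∧ b = ![1, 4, 3] t) ∨ (a = ![1, 4, 3] t ∧ b = 0) then 1 else 0)
  (hdv_κσ : ∀ (t : Fin 3) (a : Fin 5) (s : Fin 7), d (Fin.castAdd 7 (Fin.natAdd 2 t)) (Fin.castAdd 7 a) (Fin.natAdd 5 s) =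
    if a = 1 then Y t s else 0)
  (hdv_σσ : ∀ (t : Fin 3) (s u : Fin 7), d (Fin.castAdd 7 (Fin.natAdd 2 t)) (Fin.natAdd 5 s) (Fin.natAdd 5 u) = 0)
  (hdz_κκ : ∀ (j : Fin 7) (a b : Fin 5), d (Fin.natAdd 5 j) (Fin.castAdd 7 a) (Fin.castAdd 7 b) =
    ∑ t : Fin 3, (if (a = 1 ∧ b = Fin.natAdd 2 t) ∨ (a = Fin.natAdd 2 t ∧ b = 1) then Y t j else 0))
  (hdz_κσ : ∀ (j : Fin 7) (a : Fin 5) (s : Fin 7), d (Fin.natAdd 5 j) (Fin.castAdd 7 a) (Fin.natAdd 5 s) = if a = 1 then Ξ j s else 0)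
  (hdz_σσ : ∀ (j : Fin 7) (s u : Fin 7), d (Fin.natAdd 5 j) (Fin.natAdd 5 s) (Fin.natAdd 5 u) = 0)

include hcs hcc hcd hpair hΞs hdy_κκ hdy_κσ hdy_σσ hdv0_κκ hdv0_κσ hdv0_σσ hdv_κκ hdv_κσ hdv_σσ hdz_κκ hdz_κσ hdz_σσ

/-- **R4 leaf descendant 0 / w = 3, `rank Ξ = 4`, assembled.** [this work] -/
theorem tpa_R4_Z_rank4 (hΞ4 : ∀ i, Ξ i 4 = 0) (hΞ5 : ∀ i, Ξ i 5 = 0) (hΞ6 : ∀ i, Ξ i 6 = 0)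
    (hΞinj : ∀ w : Fin 7 → ZMod 2, (∀ j, (∑ s, Ξ j s * w s) = 0) → w 0 = 0 ∧ w 1 = 0 ∧ w 2 = 0 ∧ w 3 = 0) : False := by
  obtain ⟨hyy, h11, h22, -, -, -, -, -, -, hR⟩ := tpc4_scalars c d hcs hcc hcd hpair Ξ Y hdy_κκ hdy_κσ hdy_σσ hdv0_κκ hdv0_κσ hdv0_σσ
    hdv_κκ hdv_κσ hdv_σσ hdz_κκ hdz_κσ hdz_σσ
  have hZ := tpc4_Z c d hcs hcc hpair Ξ hΞs Y hdz_κκ hdz_κσ hdz_σσ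
  refine tpl_R4_Z_rank4_core (Matrix.of fun i j => Ξ i j) (Matrix.of fun i s => c (Fin.castAdd 7 1) (Fin.natAdd 5 i) (Fin.natAdd 5 s)) Y
    (fun t m => c (Fin.castAdd 7 1) (Fin.castAdd 7 (Fin.natAdd 2 t)) (Fin.natAdd 5 m))
    (c (Fin.castAdd 7 0) (Fin.castAdd 7 1) (Fin.castAdd 7 2)) (c (Fin.castAdd 7 0) (Fin.castAdd 7 3) (Fin.castAdd 7 4))
    hΞ4 hΞ5 hΞ6 (fun t => hΞinj _ (hR t)) (fun i j => ?_) hyy h11 h22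
  rw [Matrix.mul_apply]
  exact hZ i j

/-- **R4 leaf descendant 0 / w = 3, `rank Ξ = 6`, assembled.** [this work] -/
theorem tpa_R4_Z_rank6 (hΞd : ∀ i, Ξ i i = 0) (hΞ6 : ∀ i, Ξ i 6 = 0)
    (hΞinj : ∀ w : Fin 7 → ZMod 2, (∀ j, (∑ s, Ξ j s * w s) = 0) → ∀ m : Fin 7, m ≠ 6 → w m = 0) : False := by
  obtain ⟨hyy, h11, h22, h33, h21, h23, h31, h32, h00, hR⟩ := tpc4_scalars c d hcs hcc hcd hpair Ξ Y hdy_κκ hdy_κσ hdy_σσ hdv0_κκ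
    hdv0_κσ hdv0_σσ hdv_κκ hdv_κσ hdv_σσ hdz_κκ hdz_κσ hdz_σσ
  have hZ := tpc4_Z c d hcs hcc hpair Ξ hΞs Y hdz_κκ hdz_κσ hdz_σσ
  refine tpl_R4_Z_rank6_core (Matrix.of fun i j => Ξ i j) (Matrix.of fun i s => c (Fin.castAdd 7 1) (Fin.natAdd 5 i) (Fin.natAdd 5 s)) Y
    (fun t m => c (Fin.castAdd 7 1) (Fin.castAdd 7 (Fin.natAdd 2 t)) (Fin.natAdd 5 m))
    (c (Fin.castAdd 7 0) (Fin.castAdd 7 1) (Fin.castAdd 7 2)) (c (Fin.castAdd 7 0) (Fin.castAdd 7 3) (Fin.castAdd 7 4))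
    hΞs hΞd hΞ6 (fun t m hm => hΞinj _ (hR t) m hm) (fun i j => ?_) hyy h11 h22 h33 h21 h23 h31 h32 ?_
  · rw [Matrix.mul_apply]; exact hZ i j
  · simpa [Matrix.of_apply] using h00

end R4ZLeaf

end Summit.QuantumAdvantage.QuantumAdvantage.Theorems.CubicForrelation.NearExactIsExact
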